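import Summits.HodgeConjecture.HodgeConjecture.Theorems.F0P2uS2SharpTheta            -- ★ S2♯-θ `memXiFamily_of_theta_of_clauses` (+ ★ FILE 2 `F0P2uMemXiFamilyThetaNonsplit` through its imports)
import Summits.HodgeConjecture.HodgeConjecture.Theorems.F0P3cDbTThetaConstituents    -- ★ (TCᴸ) p848434 (this seat): v-constituents of a theta-type `P` (exist ∕ theta type ∕ supercuspidal)
import HarnessLib

/-!
# Crux `H413`, line LH10 «(D-b)ᵀ» — (O1-RED): THE PEEL `stubThetaLiftMember_of_occurrence : ‹O1♭′› → ‹O1›` of the organ (O1) «GLOBAL THETA MEMBER WITH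
# PRESCRIBED NON-SPLIT CLASS» of `Cruxes/H413/Lines/F0_P3c_DbTPaydown.lean` down to THETA OCCURRENCE with an automorphic, globally dictionary-tied `χ`

Cell `hodgecm-mathlib` (D-0151), FLOOR 0, crux item H413 = `stmt-HodgeConjecture-24833`; squad F0∕P3c line LH10, seat LH10-p02 (g0), DEAL «(O1-RED)» of LH10-plan (g0)
2026-09-02T02:45:18Z.  THEOREMS ONLY (no `def`, no instance, no notation, no named fact, no `sorry`); no `Cruxes/**` import (O50-1) — the organ text (O1) =
`StubThetaLiftMember` of the skeleton `F0/P3c/LH10/LH10-plan/g0/DbT.paydown.skeleton.v2.lean` :83–:113 (organ TYPE hash f8b533c39512828b) is RESTATED TOKEN FOR TOKEN as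
the conclusion; `--supports stmt-HodgeConjecture-24833`.  HONEST LABEL: HC_CM is proved only modulo the printed citations until rung 0 closes; this file proves no letter —
it REDUCES the print organ (O1) [GelbartRogawski1991 Prop. 3.4.1, Thm. 3.4 (a), Lem. 5.1.2] to the smaller statement ‹O1♭′› below.

THE REDUCTION.  ‹O1♭′› («THETA OCCURRENCE AT THE SUPERCUSPIDAL CLASS, AUTOMORPHIC DICTIONARY-TIED `χ`»): for the (O1) prefix binders (CM frame `(L, H)`, Rogawski's
`μω`, a rational theta frame `(e₁, dV, g)`, `ξ`, a DICT-tied pair `(μ, χ_f)`) and a non-split `v`, THERE ARE a global line `ε ∈ (L⁺)ˣ`, an AUTOMORPHIC character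
`χ : Chi` of `U(1)(L⁺)∖U(1)(𝔸_{L⁺,f})` with `χ.1 = χ_f` satisfying the two GLOBAL dictionary pins `μ̃ = η̃⁻¹ψ̃⁻¹μω`, `χ̌ = ψ̃⁻¹(η̃⁻¹ψ̃⁻¹μω)²` (★ FILE 1's shapes), a frame
transport `ιV` (`ιV k = g_f⁻¹ k g_f`), an automorphic measure and a DISCRETE automorphic `P` of `U(H)` with `P_f ↩ ω_H(μ, ε, χ)` (★ `HasFinComponent` of ★ `rhoAtLine … ιV ε χ`),
such that Liu's local theta type `X_v(μ, ε, χ_f)` (★ `xThetaCM`) is SUPERCUSPIDAL.  PROOF of (O1) from it: `MemXiFamily P … ξ` by ★ S2♯-θ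
`F0P2uS2SharpTheta.memXiFamily_of_theta_of_clauses` fed with ★ FILE 2 `F0P2uMemXiFamilyThetaNonsplit.nonsplit_clause_of_hasFinComponent_theta`; the two constituent
clauses («`P` has a `v`-constituent», «every `v`-constituent is supercuspidal and of theta type `X_v(μ, ε, χ_f) ∘ κ_v⁻¹`») by ★ (TCᴸ)
`F0P3cDbTThetaConstituents.exists_and_forall_isConstituentOf_theta`.  WHAT PAYS ‹O1♭′› (not here): ★ Θ-OCC-GEN `F0P2tThetaOccursInGenNeg.thetaOccursInGen` (needs
`HasWeight L μ 1` and a `μ`-admissible line — ★ (WAᴸ) `Liu2021.AdmissibleElementPrescribedLocalClass` puts the line in a prescribed class at `v`, ★ (SCᴸ)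
`F0P3cDbTSupercuspidalOffOccurringClass` names the supercuspidal class) + the globalisation DICT1∕DICT2 ⇒ global pins (density of `L^×` in `L_∞^×`, LH1-p04).

AUTOMORPHY GAP (this seat's census 2026-09-02T02:52Z, honest scope of the reduction): ‹O1♭′› asks for an AUTOMORPHIC `χ` with `χ.1 = χ_f`; for the letter's arbitrary
`ξ = (η, ψ)` and the DICT-tied `χ_f` such a `χ` exists iff `(ψ̃⁻¹ (η̃⁻¹ψ̃⁻¹μω)²)_∞ = 1` (★ `checkOfChi_infiniteIdeles`), an archimedean-type condition on `(η, ψ, μω)` that ★ FILE 1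
`F0P2uXiOfThetaDatum.exists_xi_dictionary` builds INTO its forward dictionary but that a general `ξ` need not satisfy.  So ‹O1♭′› is the in-house (theta) road to (O1) ON THE
AUTOMORPHIC LOCUS ONLY; (O1) itself is print-true everywhere ([Rogawski1990 Thm. 13.3.6 (c)] + the LOCAL [GelbartRogawski1991 Lem. 5.1.2]).  ‹O1♭′› is therefore NOT offered as a
∀-closed registered stub; it is the hypothesis of a helper theorem.

## References
* [GelbartRogawski1991] S. Gelbart, J. Rogawski, Invent. Math. 105 (1991): §3.4 Prop. 3.4.1 pp. 459–460, Thm. 3.4 (a) p. 461; §5.1 (5.1.1) p. 465, Lem. 5.1.2 p. 466.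
* [Rogawski1990] J. Rogawski, Ann. of Math. Stud. 123 (1990): §13.1 Prop. 13.1.3 (d) p. 199; §12.2 (2) p. 174; §13.3 Thm. 13.3.6 (c) p. 202; §14.6 pp. 242–245.
* [Liu2021] Y. Liu, Camb. J. Math. 9 (2021): Def. 4.11 (l. 2090–2096), Def. 4.12; App. D §D.1 (l. 5224), Lem. D.1 (1).  [Flath1979] D. Flath, PSPM 33.1: Thm. 3.
-/

set_option autoImplicit false
-- the mandated namespace repeats the single-problem summit's segment (`HodgeConjecture.HodgeConjecture`)
set_option linter.dupNamespace false

noncomputable section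

open scoped Matrix Kronecker MatrixGroups MonoidAlgebra ComplexOrder
open NumberField NumberField.InfinitePlace IsDedekindDomain MeasureTheory
open Literature.NumberTheory Literature.NumberTheory.Automorphic Literature.NumberTheory.Automorphic.UnitaryGroup
open Literature.NumberTheory.Automorphic.Liu2021 Literature.NumberTheory.Automorphic.Liu2021.AppendixC
open Literature.NumberTheory.Automorphic.Liu2021.Def411WeilCarriers
open Literature.NumberTheory.Automorphic.Liu2021.Def411WeilCarriersDoubling
open Literature.NumberTheory.Automorphic.Liu2021.CheckOfChi
open Literature.NumberTheory.Automorphic.IdeleClassGroup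
open Literature.NumberTheory.GelbartRogawski1991 Literature.NumberTheory.GelbartRogawski1991.UnitaryDualPair
open Literature.NumberTheory.GelbartRogawski1991.UnitaryDualPair.WeilCoinv
open Literature.NumberTheory.GelbartRogawski1991.UnitaryDualPair.LocalSplitting
open Literature.RepresentationTheory Literature.RepresentationTheory.Liu2021
open Literature.NumberTheory.GaloisRepresentations Literature.RepresentationTheory.HarrisKudlaSweet1996
open Literature.NumberTheory.Rogawski1990
open Summit.HodgeConjecture.CorCM
open Summit.HodgeConjecture.CorCM.Transposition
open Summit.HodgeConjecture.HodgeConjecture.Cruxes.H413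

namespace Summit.HodgeConjecture.HodgeConjecture.Cruxes.H413.F0P3cDbTThetaLiftMemberOfTheta

set_option synthInstance.maxHeartbeats 400000 in
set_option maxHeartbeats 16000000 in
/-- **(O1-RED) — THE PEEL `‹O1♭′› → ‹O1›`.**  HYPOTHESIS ‹O1♭′› «theta occurrence at the supercuspidal class with an automorphic, globally dictionary-tied `χ`»: for the (O1)
prefix binders and a non-split `v`, some global line `ε`, some automorphic `χ : Chi` with `χ.1 = χ_f` under the two GLOBAL pins, some frame transport `ιV` (`ιV k = g_f⁻¹ k g_f`),
some automorphic measure and some discrete `P` with `P.HasFinComponent (rhoAtLine … ιV ε χ)`, and `X_v(μ, ε, χ_f)` supercuspidal.  CONCLUSION = the organ (O1)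
`StubThetaLiftMember` of `Cruxes/H413/Lines/F0_P3c_DbTPaydown.lean` (skeleton v2 :83–:113) TOKEN FOR TOKEN: `∃ ε μA P`, `MemXiFamily P hH hHd μω hμu ξ` (★ S2♯-θ assembly over
★ FILE 2's non-split clause), a `v`-constituent exists and every `v`-constituent is supercuspidal of theta type `X_v(μ, ε, χ_f) ∘ κ_v⁻¹` (★ (TCᴸ)).
[cite: GelbartRogawski1991, §3.4 Prop. 3.4.1 pp. 459–460, Thm. 3.4 (a) p. 461; §5.1 (5.1.1) p. 465, Lem. 5.1.2 p. 466] [cite: Rogawski1990, §13.1 Prop. 13.1.3 (d) p. 199; §14.6 pp. 242–245]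
[cite: Liu2021, Def. 4.11 (l. 2090–2096); App. D §D.1 (l. 5224), Lem. D.1 (1)] -/
theorem stubThetaLiftMember_of_occurrence
    (hocc : ∀ (L : Type) [Field L] [NumberField L] [IsCMField L] (H : Matrix (Fin 3) (Fin 3) L)
      (hH : (H.map (cmConjRingHom L))ᵀ = H) (hHd : IsUnit H.det) (μω : HeckeCharacter L) (hμu : μω.IsUnitary),
      (∀ x : Literature.NumberTheory.GaloisRepresentations.ideleGroup ↥(maximalRealSubfield L),
        μω (AdeleRing.ideleBaseChange (↥(maximalRealSubfield L)) L x) = quadraticHeckeCharCM L x) →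
      ∀ {n' : ℕ} (e₁ : Fin 3 × Fin 1 ≃ Fin n') (dV : Fin 3 → L) (hdV : ∀ i, IsCMField.complexConj L (dV i) = dV i) (hdV0 : ∀ i, dV i ≠ 0)
        (g : GL (Fin 3) L) (hg : ((g : Matrix (Fin 3) (Fin 3) L).map (cmConjRingHom L))ᵀ * H * (g : Matrix (Fin 3) (Fin 3) L) = Matrix.diagonal dV)
        (ξ : OneDimAutRepH L)
        (μ : Literature.NumberTheory.Automorphic.IdeleClassGroup L →ₜ* Circle) (hμ : IsConjugateSymplectic L μ)
        (χf : UnitaryGroup.finAdelicOne (↥(maximalRealSubfield L)) L (IsCMField.complexConj L) →* ℂˣ),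
        Continuous χf → (∀ z, ‖((χf z : ℂˣ) : ℂ)‖ = 1) →
        (∀ v : HeightOneSpectrum (𝓞 ↥(maximalRealSubfield L)),
            (toHeckeCharacter L μ).semilocalComponent L v = (ξ.bcη⁻¹ * ξ.bcψ⁻¹ * μω).semilocalComponent L v) →
        (∀ z : (FiniteAdeleRing (𝓞 L) L)ˣ,
            χf (finAdelicCheck (↥(maximalRealSubfield L)) L (IsCMField.complexConj L)
                (AlgEquiv.ext fun x => by rw [AlgEquiv.mul_apply, IsCMField.complexConj_apply_apply, AlgEquiv.one_apply]) z) =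
              (ξ.bcψ⁻¹ * (ξ.bcη⁻¹ * ξ.bcψ⁻¹ * μω) ^ 2)
                (Units.map (N := AdeleRing (𝓞 L) L) (MonoidHom.inr (InfiniteAdeleRing L) (FiniteAdeleRing (𝓞 L) L)) z)) →
        ∀ (v : HeightOneSpectrum (𝓞 ↥(maximalRealSubfield L))), (∀ w : PlacesOver L v, IsCMField.complexConj L • w.1 = w.1) →
          ∃ (ε : (↥(maximalRealSubfield L))ˣ) (χ : Chi (↥(maximalRealSubfield L)) L (IsCMField.complexConj L)) (_ : χ.1 = χf)
            (_ : toHeckeCharacter L μ = ξ.bcη⁻¹ * ξ.bcψ⁻¹ * μω)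
            (_ : HeckeCharacter.checkOfChi (Def411WeilCarriers.complexConj_mul_complexConj' L) χ = ξ.bcψ⁻¹ * (ξ.bcη⁻¹ * ξ.bcψ⁻¹ * μω) ^ 2)
            (ιV : finAdelic (↥(maximalRealSubfield L)) L (IsCMField.complexConj L) 3 H →*
              finAdelic (↥(maximalRealSubfield L)) L (IsCMField.complexConj L) 3 (Matrix.diagonal dV))
            (_ : ∀ k, ((ιV k : finAdelic (↥(maximalRealSubfield L)) L (IsCMField.complexConj L) 3 (Matrix.diagonal dV)) :
                  GL (Fin 3) (FiniteAdeleRing (𝓞 L) L)) =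
                (toFinAdeleGL L 3 g)⁻¹ * (k : GL (Fin 3) (FiniteAdeleRing (𝓞 L) L)) * toFinAdeleGL L 3 g)
            (μA : Measure (adelicGroupData (↥(maximalRealSubfield L)) L (IsCMField.complexConj L) 3 H).automorphicQuotient)
            (_ : (adelicGroupData (↥(maximalRealSubfield L)) L (IsCMField.complexConj L) 3 H).IsAutomorphicMeasure μA)
            (P : DiscreteAutomorphicRep (adelicGroupData (↥(maximalRealSubfield L)) L (IsCMField.complexConj L) 3 H) μA),
            P.HasFinComponent
              (rhoAtLine (↥(maximalRealSubfield L)) L (IsCMField.complexConj L) 3 e₁ (Matrix.diagonal dV)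
                (complexConj_imagUnit L) (imagUnit_ne_zero L) (imagUnit_mul_self L) (realDiagonal_isSymm L dV hdV)
                (isUnit_det_realDiagonal L dV hdV hdV0) (realDiagonal_map L dV hdV).symm
                (fun a => isCompatible_chiSplittingLine L e₁ dV hdV hdV0 (toHeckeCharacter L μ)
                  (isUnitary_toHeckeCharacter L μ) ((isOscillatorChar_toHeckeCharacter_iff μ).mpr hμ)
                  (TW (↥(maximalRealSubfield L)) a) (isSymm_TW (↥(maximalRealSubfield L)) a)
                  (isUnit_det_TW (↥(maximalRealSubfield L)) a) (JW (↥(maximalRealSubfield L)) L a)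
                  (JW_eq (↥(maximalRealSubfield L)) L a)) ιV ε χ) ∧
            (xThetaCM L e₁ dV hdV hdV0 μ hμ χf ε v).IsSupercuspidal) :
    ∀ (L : Type) [Field L] [NumberField L] [IsCMField L] (H : Matrix (Fin 3) (Fin 3) L)
      (hH : (H.map (cmConjRingHom L))ᵀ = H) (hHd : IsUnit H.det) (μω : HeckeCharacter L) (hμu : μω.IsUnitary),
      (∀ x : Literature.NumberTheory.GaloisRepresentations.ideleGroup ↥(maximalRealSubfield L),
        μω (AdeleRing.ideleBaseChange (↥(maximalRealSubfield L)) L x) = quadraticHeckeCharCM L x) →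
      ∀ {n' : ℕ} (e₁ : Fin 3 × Fin 1 ≃ Fin n') (dV : Fin 3 → L) (hdV : ∀ i, IsCMField.complexConj L (dV i) = dV i) (hdV0 : ∀ i, dV i ≠ 0)
        (g : GL (Fin 3) L) (hg : ((g : Matrix (Fin 3) (Fin 3) L).map (cmConjRingHom L))ᵀ * H * (g : Matrix (Fin 3) (Fin 3) L) = Matrix.diagonal dV)
        (ξ : OneDimAutRepH L)
        (μ : Literature.NumberTheory.Automorphic.IdeleClassGroup L →ₜ* Circle) (hμ : IsConjugateSymplectic L μ)
        (χf : UnitaryGroup.finAdelicOne (↥(maximalRealSubfield L)) L (IsCMField.complexConj L) →* ℂˣ),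
        Continuous χf → (∀ z, ‖((χf z : ℂˣ) : ℂ)‖ = 1) →
        (∀ v : HeightOneSpectrum (𝓞 ↥(maximalRealSubfield L)),
            (toHeckeCharacter L μ).semilocalComponent L v = (ξ.bcη⁻¹ * ξ.bcψ⁻¹ * μω).semilocalComponent L v) →
        (∀ z : (FiniteAdeleRing (𝓞 L) L)ˣ,
            χf (finAdelicCheck (↥(maximalRealSubfield L)) L (IsCMField.complexConj L)
                (AlgEquiv.ext fun x => by rw [AlgEquiv.mul_apply, IsCMField.complexConj_apply_apply, AlgEquiv.one_apply]) z) =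
              (ξ.bcψ⁻¹ * (ξ.bcη⁻¹ * ξ.bcψ⁻¹ * μω) ^ 2)
                (Units.map (N := AdeleRing (𝓞 L) L) (MonoidHom.inr (InfiniteAdeleRing L) (FiniteAdeleRing (𝓞 L) L)) z)) →
        ∀ (v : HeightOneSpectrum (𝓞 ↥(maximalRealSubfield L))), (∀ w : PlacesOver L v, IsCMField.complexConj L • w.1 = w.1) →
          ∃ (ε : (↥(maximalRealSubfield L))ˣ)
            (μA : Measure (adelicGroupData (↥(maximalRealSubfield L)) L (IsCMField.complexConj L) 3 H).automorphicQuotient)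
            (_ : (adelicGroupData (↥(maximalRealSubfield L)) L (IsCMField.complexConj L) 3 H).IsAutomorphicMeasure μA)
            (P : DiscreteAutomorphicRep (adelicGroupData (↥(maximalRealSubfield L)) L (IsCMField.complexConj L) 3 H) μA),
            MemXiFamily P hH hHd μω hμu ξ ∧
            (∃ c : IrrClass ((cmDatum L 3 H).Local v),
              (IrrClass.comap (localPiEquiv L (IsCMField.complexConj L) 3 H v) c).IsConstituentOf
                (P.finRep.smoothPart.toRepresentation.comp (inclPlace (↥(maximalRealSubfield L)) L (IsCMField.complexConj L) 3 H v))) ∧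
            ∀ c : IrrClass ((cmDatum L 3 H).Local v),
              (IrrClass.comap (localPiEquiv L (IsCMField.complexConj L) 3 H v) c).IsConstituentOf
                  (P.finRep.smoothPart.toRepresentation.comp (inclPlace (↥(maximalRealSubfield L)) L (IsCMField.complexConj L) 3 H v)) →
                c.IsSupercuspidal ∧ ThetaTypeAtCM L H e₁ dV hdV hdV0 g hg μ hμ χf ε v c
    := by
  intro L _ _ _ H hH hHd μω hμu hμω n' e₁ dV hdV hdV0 g hg ξ μ hμ χf hχc hχn hD1 hD2 v hns
  obtain ⟨ε, χ, hχ, hμξ, hχξ, ιV, hιV, μA, hμA, P, hfin, hsc⟩ :=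
    hocc L H hH hHd μω hμu hμω e₁ dV hdV hdV0 g hg ξ μ hμ χf hχc hχn hD1 hD2 v hns
  subst hχ
  haveI := hμA
  refine ⟨ε, μA, hμA, P, ?_, F0P3cDbTThetaConstituents.exists_and_forall_isConstituentOf_theta L H e₁ dV hdV hdV0 g hg ιV hιV
    μA P μ hμ ε χ hfin v hsc⟩
  -- `MemXiFamily P … ξ`: ★ S2♯-θ assembly over ★ FILE 2's non-split clause at the GLOBAL pins
  exact F0P2uS2SharpTheta.memXiFamily_of_theta_of_clauses L H hH hHd e₁ dV hdV hdV0 g hg ιV hιV μA P ξ μω hμu μ hμ ε χ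
    (Def411WeilCarriers.complexConj_mul_complexConj' L) hμξ hχξ hfin
    (fun w hw => F0P2uMemXiFamilyThetaNonsplit.nonsplit_clause_of_hasFinComponent_theta L H hH hHd e₁ dV hdV hdV0 g hg ιV hιV μA P
      μω hμu hμω μ hμ ε χ hfin ξ (Def411WeilCarriers.complexConj_mul_complexConj' L) hμξ hχξ w hw)

end Summit.HodgeConjecture.HodgeConjecture.Cruxes.H413.F0P3cDbTThetaLiftMemberOfTheta

end
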